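import Summits.BirchSwinnertonDyer.BirchSwinnertonDyer.Theorems.ByReductionTypeAtTwoSupersingularColemanClass157113h
import Summits.BirchSwinnertonDyer.BirchSwinnertonDyer.Theorems.ByReductionTypeAtTwoSupersingularThetaClassKit
import Summits.BirchSwinnertonDyer.BirchSwinnertonDyer.Theorems.ByReductionTypeAtTwoSupersingularThetaPartnersA
import Summits.BirchSwinnertonDyer.BirchSwinnertonDyer.Theorems.ByReductionTypeAtTwoSupersingularThetaHabitatMainConjecture
import HarnessLib

/-!
# Crux `SupersingularRankZeroAtTwo` (item stmt-BirchSwinnertonDyer-19097, route ByReductionTypeAtTwo, rung K4):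
# CLASS INSTANCE on the THETA (CM-partner transport) road — the X5@2 good-supersingular `a₂ = 0` class **157113h**
# (member `157113h1 = [0, 0, 1, -2285565660, -42057036462382]`, `N = 157113`) with its rank-`0` CM partner `cmA27a` = Cremona 27a3 = y² + y = x³ (`[0, 0, 1, 0, 0]`, `N = 27`, CM field `ℚ(√−3)`)
# — seat `bsd-2adic-ss-1x` (WIDTH-LEVER second lane), generator `work/theta/gen/gen_theta.py`, Tschirnhaus data kit job j277974

HONEST FRAMING (cell `bsd-2adic`, run/shared/lean/pub/bsd-2adic/, HUMAN RULINGS D-0036/D-0054/D-0074): a CLASS INSTANCE, not a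
booking; THEOREMS ONLY; no definition, no named fact, no instance; BSD is NOT proved by any of this. PARTITION (D-0054): X5@2
good-supersingular, `a₂ = 0` THETA-HABITAT sub-row (B1·O1; 19 of 208 rank-`0` classes) × `p = 2` — types-the-object-of (item 19097
AT the class `157113h` by route ThetaPartnerAtTwo's items); closes none. The instance keeps as HYPOTHESES the PRINT binders
{modularity `hmod`, GZK `hGZK`} (accepted named facts), TP2's FOUR K-ITEMS BY NAME {K1 `SignedTransportAtTwo` (20333), K2r0
`SignedMainConjectureCMTwoRankZero` (20312), K3 `SignedKatoDivisibilityUpToAtTwo` (20308), K4 `SignedControlAtTwo` (20309)} —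
resp., in the second display, 19097's registered stubs (1) (1′) (2′) (4) VERBATIM + K1 + K2r0 — and the two per-curve
CERTIFICATES `L(E,1) ≠ 0` (Cremona) and `L(A,1) ≠ 0` (0.58888 (Cremona allbsd); HABITAT-CENSUS-TP2-v1.1).
KERNEL-DECIDED here: everything about `E` (lane `bsd-2adic-ss-1`'s class file `…SupersingularColemanClass157113h`: `Δ`, minimality,
good supersingular at `2` with `a₂ = 0`, no CM) and `A` (`…SupersingularThetaPartnersA`: `Δ`, minimality, good supersingular
at `2` with `a₂ = 0`, CM by its `j`-invariant), AND the habitat clause **`E[2] ≅ A[2]` as Galois modules** by the Tschirnhaus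
certificate on the `2`-division cubics `ψ = 4x³ + b₂x² + 2b₄x + b₆`: `q = [322600320/253, 403225/17457, -112/133837]`, `r = [0, -43815, 69552]` with `ψ_A(q(ξ)) = s(ξ)ψ_E(ξ)`,
`r(q(ξ)) − ξ = t(ξ)ψ_E(ξ)` (`s = [-262242445848800759/5319965742993, 71120/53737027707, 5058054400/104231921409011, -1404928/2397334192407253]`, `t = [-22761244800/33860761, 9483264/778797503]`; PARI `nfisisom`, kit j277974; checked below by `linear_combination` over `ℚ̄`).
References: [CremonaAlgorithms1997] Table 1 (157113h1); [SilvermanAEC2009] III.§1, Cor. III.6.4(b), VII.1, App. C §11;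
[GreenbergVatsal2000] Thm. (1.4); [Kobayashi2003] Thm. 1.2, 4.1; [BDKim2013] Cor. 3.15; [PollackRubin2004] Thm. 7.3;
[Kato2004Asterisque] Thm. 12.4–12.5; [Miller2011LMS] Def. 1.1; HABITAT-CENSUS-TP2-v1.md §3 (class 157113h1).
-/

set_option autoImplicit false
-- the Theorems namespace of this sub repeats the summit name by design (D-0017 nested layout)
set_option linter.dupNamespace false

noncomputable section

open scoped Classical Polynomial

open CongruenceSubgroup WeierstrassCurve Literature.NumberTheory.EllipticCurves
  Literature.NumberTheory.EllipticCurves.ModularForms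
  Literature.NumberTheory.EllipticCurves.Rank1Residual Literature.NumberTheory.EllipticCurves.Rank1Residual.Typed
  Literature.NumberTheory.EllipticCurves.Kobayashi2003 Literature.NumberTheory.EllipticCurves.IwasawaDual
  ZpExtension Summit.BirchSwinnertonDyer.Rank1Residual Summit.BirchSwinnertonDyer.Rank1Residual.Supersingular
  Summit.BirchSwinnertonDyer.Rank1Residual.X5 Summit.BirchSwinnertonDyer.Rank1Residual.X5.O1
  Summit.BirchSwinnertonDyer.Rank1Residual.X5.Instances
  Summit.BirchSwinnertonDyer.BirchSwinnertonDyer.Theses.ThetaPartnerAtTwo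

namespace Summit.BirchSwinnertonDyer.BirchSwinnertonDyer.Theorems
namespace SSThetaRoad

/-! ## §1 The habitat clause for `157113h1`: `E[2] ≅ cmA27a[2]` by the Tschirnhaus certificate -/

/-- **Certificate, root clause**: for every root `ξ ∈ ℚ̄` of `ψ_E` (`E = 157113h1`), `q(ξ)` is a root of `ψ_A`
(`A = cmA27a`), `q = [322600320/253, 403225/17457, -112/133837]`: `ψ_A(q(ξ)) = s(ξ) · ψ_E(ξ)` with `s = [-262242445848800759/5319965742993, 71120/53737027707, 5058054400/104231921409011, -1404928/2397334192407253]`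
(PARI `nfisisom`, kit j277974; `linear_combination` over `ℚ̄`). [cite: SilvermanAEC2009, III.§1] -/
theorem tschirnhaus_root_157113h1 (ξ : AlgebraicClosure ℚ)
    (hξ : Polynomial.aeval ξ ((⟨0, 0, 1, -2285565660, -42057036462382⟩ : WeierstrassCurve ℤ).baseChange ℚ).twoTorsionPolynomial.toPoly = 0) :
    Polynomial.aeval (Polynomial.aeval ξ (Polynomial.C ((322600320 : ℚ) / 253) + Polynomial.C ((403225 : ℚ) / 17457) * Polynomial.X + Polynomial.C ((-112 : ℚ) / 133837) * Polynomial.X ^ 2))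
      ((⟨0, 0, 1, 0, 0⟩ : WeierstrassCurve ℤ).baseChange ℚ).twoTorsionPolynomial.toPoly = 0 := by
  haveI : CharZero (AlgebraicClosure ℚ) := charZero_algebraicClosure_rat
  rw [aeval_twoTorsionPolynomial_baseChange_int] at hξ
  rw [aeval_quadratic, aeval_twoTorsionPolynomial_baseChange_int]
  obtain ⟨hb₂, hb₄, hb₆⟩ := SSColemanRoad.M157113h1_b
  obtain ⟨hc₂, hc₄, hc₆⟩ := cmA27a_b
  rw [hb₂, hb₄, hb₆] at hξ
  rw [hc₂, hc₄, hc₆]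
  push_cast at hξ ⊢
  linear_combination (((-262242445848800759 : AlgebraicClosure ℚ) / 5319965742993) + ((71120 : AlgebraicClosure ℚ) / 53737027707) * ξ + ((5058054400 : AlgebraicClosure ℚ) / 104231921409011) * ξ ^ 2 + ((-1404928 : AlgebraicClosure ℚ) / 2397334192407253) * ξ ^ 3) * hξ

/-- **Certificate, inverse clause**: `r(q(ξ)) = ξ` for every root `ξ` of `ψ_E`, `r = [0, -43815, 69552]`:
`r(q(ξ)) − ξ = t(ξ) · ψ_E(ξ)` with `t = [-22761244800/33860761, 9483264/778797503]` (kit j277974). [cite: SilvermanAEC2009, III.§1] -/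
theorem tschirnhaus_inv_157113h1 (ξ : AlgebraicClosure ℚ)
    (hξ : Polynomial.aeval ξ ((⟨0, 0, 1, -2285565660, -42057036462382⟩ : WeierstrassCurve ℤ).baseChange ℚ).twoTorsionPolynomial.toPoly = 0) :
    Polynomial.aeval (Polynomial.aeval ξ (Polynomial.C ((322600320 : ℚ) / 253) + Polynomial.C ((403225 : ℚ) / 17457) * Polynomial.X + Polynomial.C ((-112 : ℚ) / 133837) * Polynomial.X ^ 2))
      (Polynomial.C (0 : ℚ) + Polynomial.C (-43815 : ℚ) * Polynomial.X + Polynomial.C (69552 : ℚ) * Polynomial.X ^ 2) = ξ := by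
  haveI : CharZero (AlgebraicClosure ℚ) := charZero_algebraicClosure_rat
  rw [aeval_twoTorsionPolynomial_baseChange_int] at hξ
  rw [aeval_quadratic, aeval_quadratic]
  obtain ⟨hb₂, hb₄, hb₆⟩ := SSColemanRoad.M157113h1_b
  rw [hb₂, hb₄, hb₆] at hξ
  push_cast at hξ ⊢
  linear_combination (((-22761244800 : AlgebraicClosure ℚ) / 33860761) + ((9483264 : AlgebraicClosure ℚ) / 778797503) * ξ) * hξ

/-- **`157113h1[2] ≅ cmA27a[2]` as Galois modules — the habitat clause of `WAllNonCMAtTwoThetaHabitat` / TP2 K1 at this class,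
KERNEL-CHECKED** (Tschirnhaus road, `ThetaPartnerXRoute.exists_equivariant_addEquiv_geomTorsion_two_of_tschirnhaus`).
[cite: SilvermanAEC2009, III.§1, Cor. III.6.4(b) and VIII.§1] -/
theorem twoTorsion_congruent_157113h1 :
    ∃ e : geomTorsion ((⟨0, 0, 1, -2285565660, -42057036462382⟩ : WeierstrassCurve ℤ).baseChange ℚ) (2 : ℤ) ≃+ geomTorsion ((⟨0, 0, 1, 0, 0⟩ : WeierstrassCurve ℤ).baseChange ℚ) (2 : ℤ),
      ∀ (σ : Field.absoluteGaloisGroup ℚ) (P : geomTorsion ((⟨0, 0, 1, -2285565660, -42057036462382⟩ : WeierstrassCurve ℤ).baseChange ℚ) (2 : ℤ)), e (σ • P) = σ • e P :=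
  haveI := SSColemanRoad.isElliptic_157113h1
  haveI := isElliptic_cmA27a
  ThetaPartnerXRoute.exists_equivariant_addEquiv_geomTorsion_two_of_tschirnhaus (K := ℚ) two_ne_zero _ _ _ _
    tschirnhaus_root_157113h1 tschirnhaus_inv_157113h1

/-- **The theta-habitat WITNESS for `157113h1`** — the hypothesis `hH` of the slice leaf `WAllNonCMAtTwoThetaHabitat` / of TP2's
`closes` AT this curve: a rank-`0` CM partner (`cmA27a`), good supersingular at `2` with `a₂ = 0`, and a Galois-equivariant
`E[2] ≃ A[2]` — everything kernel-decided except the certificate `L(A,1) ≠ 0` (`hLA`). For any consumer of the habitat clause.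
[cite: SilvermanAEC2009, III.§1, Cor. III.6.4(b), VII.5 Prop. 5.1 and App. C §11] -/
theorem thetaHabitatWitness_157113h1 (hLA : ((⟨0, 0, 1, 0, 0⟩ : WeierstrassCurve ℤ).baseChange ℚ).entireLFunction 1 ≠ 0) :
    ∃ (A : WeierstrassCurve ℚ) (_ : A.IsElliptic) (_ : A.IsGloballyMinimal),
      A.HasCM ∧ A.analyticRank = 0 ∧ GoodSS A 2 ∧ A.frobeniusTrace 2 = 0 ∧
        ∃ e : geomTorsion ((⟨0, 0, 1, -2285565660, -42057036462382⟩ : WeierstrassCurve ℤ).baseChange ℚ) (2 : ℤ) ≃+ geomTorsion A (2 : ℤ),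
          ∀ (σ : Field.absoluteGaloisGroup ℚ) (P : geomTorsion ((⟨0, 0, 1, -2285565660, -42057036462382⟩ : WeierstrassCurve ℤ).baseChange ℚ) (2 : ℤ)), e (σ • P) = σ • e P := by
  haveI := isElliptic_cmA27a
  haveI := isGloballyMinimal_cmA27a
  obtain ⟨e, he⟩ := twoTorsion_congruent_157113h1
  exact ⟨_, isElliptic_cmA27a, isGloballyMinimal_cmA27a, hasCM_cmA27a,
    analyticRank_eq_zero_of_entireLFunction_one_ne_zero _ hLA, goodSS_two_cmA27a.2.2, goodSS_two_cmA27a.2.1, e, he⟩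

/-! ## §2 `BSD(157113h1, 2)` on the theta (CM-partner transport) road -/

/-- **`BSD(157113h1, 2)` ON THE THETA ROAD, TP2's items by name** — class instance of crux `SupersingularRankZeroAtTwo` at the
habitat class `157113h`. Displayed: PRINT {`hmod`, `hGZK`}; TP2 ITEMS {K1 `hT`, K2r0 `hCM`, K3 `hKato`, K4 `hStr`}; CERT
{`L(E,1) ≠ 0`, `L(A,1) ≠ 0`}. KERNEL: `E` non-CM, good supersingular at `2` with `a₂ = 0`, globally minimal; the partner
`A = cmA27a` CM, good supersingular at `2` with `a₂ = 0`, globally minimal; `E[2] ≅ A[2]`. Closes nothing by itself.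
[cite: GreenbergVatsal2000, Thm. (1.4)] [cite: Kobayashi2003, Thm. 1.2 and Thm. 4.1] [cite: BDKim2013, Cor. 3.15]
[cite: PollackRubin2004, Thm. 7.3] [cite: CremonaAlgorithms1997, Table 1] [cite: Miller2011LMS, Def. 1.1] -/
theorem bsdp_two_157113h1_of_thetaPartner
    (hmod : nonempty_modularParametrizationData) (hGZK : rank_eq_analyticRank_of_analyticRank_le_one)
    (hT : SignedTransportAtTwo) (hCM : SignedMainConjectureCMTwoRankZero)
    (hKato : SignedKatoDivisibilityUpToAtTwo) (hStr : SignedControlAtTwo)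
    (hLA : ((⟨0, 0, 1, 0, 0⟩ : WeierstrassCurve ℤ).baseChange ℚ).entireLFunction 1 ≠ 0) :
    ∀ (W : WeierstrassCurve ℚ) [W.IsElliptic] [W.IsGloballyMinimal],
      W = (⟨0, 0, 1, -2285565660, -42057036462382⟩ : WeierstrassCurve ℤ).baseChange ℚ → W.entireLFunction 1 ≠ 0 → BSDp W 2 := by
  intro W _ _ hW hL
  subst hW
  haveI := isElliptic_cmA27a
  haveI := isGloballyMinimal_cmA27a
  exact bsdp_two_baseChange_int_of_thetaPartner _ _ hmod hGZK hT hCM hKato hStr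
    SSColemanRoad.not_hasCM_157113h1 hL SSColemanRoad.goodSS_two_157113h1.2.2 SSColemanRoad.goodSS_two_157113h1.2.1
    hasCM_cmA27a hLA goodSS_two_cmA27a.2.2 goodSS_two_cmA27a.2.1 _ _
    tschirnhaus_root_157113h1 tschirnhaus_inv_157113h1

/-- **`BSD(157113h1, 2)` ON THE THETA ROAD from 19097's registered stubs (1) (1′) (2′) (4) VERBATIM + TP2's K1, K2r0** — the
HARDEST stub (3) `stub_zeroKobayashiLower` and the conjecture stub (4′) `stub_zeroMuPlusOfNonSurj` are NOT used at this
class. Displayed: stubs {`hPub`, `hKatoPub`, `hEC`, `hCK`}; TP2 ITEMS {K1 `hT`, K2r0 `hCM`}; CERT {`L(E,1) ≠ 0`, `L(A,1) ≠ 0`}.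
KERNEL as above. Closes nothing by itself. [cite: Kobayashi2003, Thm. 1.2, Thm. 4.1 and §7] [cite: BDKim2013, Cor. 3.15]
[cite: Kato2004Asterisque, Thm. 12.4–12.5] [cite: GreenbergVatsal2000, Thm. (1.4)] [cite: Miller2011LMS, Def. 1.1] -/
theorem bsdp_two_157113h1_of_signedTransport_of_stubs
    (hPub : nonempty_modularParametrizationData ∧ rank_eq_analyticRank_of_analyticRank_le_one)
    (hKatoPub : Kato2004.thm12_4 ∧ Kato2004_fineSelmerDual_isTorsion)
    (hEC : ∀ (W : WeierstrassCurve ℚ) [W.IsElliptic] [W.IsGloballyMinimal],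
        ¬ W.HasCM → W.analyticRank = 0 → GoodSS W 2 → W.frobeniusTrace 2 = 0 →
        ∀ (κ : ZpExtension ℚ 2) (γ : Field.absoluteGaloisGroup ℚ),
          κ.IsCyclotomic → κ.IsTopGenerator γ → Finite (W.selmerGroupPInfty 2) →
          Finite (endInvariants (conjSignedSelmerInfty W κ 1 γ - 1)) ∧
            ∃ u : ℤ_[2]ˣ, (Nat.card (endInvariants (conjSignedSelmerInfty W κ 1 γ - 1)) : ℚ_[2]) =
              ((u : ℤ_[2]) : ℚ_[2]) * ((2 : ℕ) : ℚ_[2]) ^ (padicValNat 2 W.tamagawaProduct) *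
                (Nat.card (W.selmerGroupPInfty 2) : ℚ_[2]) *
                  (Nat.card (EndCoinvariants (conjSignedSelmerInfty W κ 1 γ - 1)) : ℚ_[2]))
    (hCK : ∀ (W : WeierstrassCurve ℚ) [W.IsElliptic] [W.IsGloballyMinimal],
      ¬ W.HasCM → W.analyticRank = 0 → GoodSS W 2 → W.frobeniusTrace 2 = 0 →
      ∀ (κ : ZpExtension ℚ 2) (γ : Field.absoluteGaloisGroup ℚ),
        κ.IsCyclotomic → κ.IsTopGenerator γ → IsCyclotomicVariable 2 γ →
        ∀ [NeZero (W.conductorNorm ℤ)] (f : CuspForm (Gamma0 (W.conductorNorm ℤ)) 2),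
          IsNewformOf W f → ∀ (ϖ : ℚ), (ϖ : ℝ) * W.realPeriodRat = plusPeriod f →
        ∀ (Lplus Lminus : IwasawaAlgebra 2), IsPollackPair f 2 Lplus Lminus →
        ∀ (D : SignedSelmerDualData W κ γ 1) [ContinuousSMul ℤ_[2] (W.tateModule 2)],
          ∃ (I : Kato2004.IwasawaH1Data W 2 κ γ) (Y : W.FineSelmerDualData κ γ)
            (P : Submodule (IwasawaAlgebra 2) (IwasawaAlgebra 2))
            (loc : I.H →ₗ[IwasawaAlgebra 2] P) (toX : P →ₗ[IwasawaAlgebra 2] D.X)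
            (δ : D.X →ₗ[IwasawaAlgebra 2] Y.X) (Z : Submodule (IwasawaAlgebra 2) I.H)
            (G : IwasawaAlgebra 2),
            Function.Exact loc toX ∧ Function.Exact toX δ ∧
            G ∈ Submodule.map (P.subtype ∘ₗ loc) Z ∧
            iwasawaToPowerSeries 2 G =
              PowerSeries.C (ϖ : ℚ_[2]) * iwasawaToPowerSeries 2 (kobayashiL 1 Lplus Lminus) ∧
            (∀ 𝔭 : PrimeSpectrum (IwasawaAlgebra 2), 𝔭.asIdeal.height = 1 →
              PowerSeries.C (2 : ℤ_[2]) ∉ 𝔭.asIdeal →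
              Literature.NumberTheory.EllipticCurves.Module.lengthAt (IwasawaAlgebra 2) Y.X 𝔭 ≤
                Literature.NumberTheory.EllipticCurves.Module.lengthAt (IwasawaAlgebra 2) (I.H ⧸ Z) 𝔭) ∧
            (TwoAdicSurjective W →
              ∀ 𝔭 : PrimeSpectrum (IwasawaAlgebra 2), 𝔭.asIdeal.height = 1 →
                PowerSeries.C (2 : ℤ_[2]) ∈ 𝔭.asIdeal →
                Literature.NumberTheory.EllipticCurves.Module.lengthAt (IwasawaAlgebra 2) Y.X 𝔭 ≤
                  Literature.NumberTheory.EllipticCurves.Module.lengthAt (IwasawaAlgebra 2) (I.H ⧸ Z) 𝔭))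
    (hT : SignedTransportAtTwo) (hCM : SignedMainConjectureCMTwoRankZero)
    (hLA : ((⟨0, 0, 1, 0, 0⟩ : WeierstrassCurve ℤ).baseChange ℚ).entireLFunction 1 ≠ 0) :
    ∀ (W : WeierstrassCurve ℚ) [W.IsElliptic] [W.IsGloballyMinimal],
      W = (⟨0, 0, 1, -2285565660, -42057036462382⟩ : WeierstrassCurve ℤ).baseChange ℚ → W.entireLFunction 1 ≠ 0 → BSDp W 2 := by
  intro W _ _ hW hL
  subst hW
  haveI := isElliptic_cmA27a
  haveI := isGloballyMinimal_cmA27a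
  exact bsdp_two_baseChange_int_of_signedTransport_of_stubs _ _ hPub hKatoPub hEC hCK hT hCM
    SSColemanRoad.not_hasCM_157113h1 hL SSColemanRoad.goodSS_two_157113h1.2.2 SSColemanRoad.goodSS_two_157113h1.2.1
    hasCM_cmA27a hLA goodSS_two_cmA27a.2.2 goodSS_two_cmA27a.2.1 _ _
    tschirnhaus_root_157113h1 tschirnhaus_inv_157113h1

/-! ## §3 Kobayashi's `+` main conjecture at `2` for `157113h1` (a NON-CM curve) on the theta road — what TP2 buys here -/

/-- **`KobayashiMainConjecture(157113h1, 2, +) ∧ KobayashiLowerDivisibility(157113h1, 2, +)` ON THE THETA ROAD** — the INTEGRAL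
signed main conjecture at `2` for this non-CM class member, and in particular the conclusion of 19097's HARDEST stub (3)
`stub_zeroKobayashiLower` AT this curve, from modularity + TP2's K1 `hT`, K2r0 `hCM`, K3 `hKato` BY NAME + the two
certificates `L(E,1) ≠ 0`, `L(A,1) ≠ 0`; partner, reduction types, CM and `E[2] ≅ A[2]` kernel-decided. Closes nothing.
[cite: Kobayashi2003, Conjecture (p. 2) and Thm. 4.1] [cite: GreenbergVatsal2000, Thm. (1.4)] [cite: PollackRubin2004, Thm. 7.3]
[cite: CremonaAlgorithms1997, Table 1] -/
theorem kobayashiMainConjecture_two_157113h1_of_thetaPartner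
    (hmod : nonempty_modularParametrizationData) (hT : SignedTransportAtTwo) (hCM : SignedMainConjectureCMTwoRankZero)
    (hKato : SignedKatoDivisibilityUpToAtTwo) (hLA : ((⟨0, 0, 1, 0, 0⟩ : WeierstrassCurve ℤ).baseChange ℚ).entireLFunction 1 ≠ 0) :
    ∀ (W : WeierstrassCurve ℚ) [W.IsElliptic] [W.IsGloballyMinimal],
      W = (⟨0, 0, 1, -2285565660, -42057036462382⟩ : WeierstrassCurve ℤ).baseChange ℚ → W.entireLFunction 1 ≠ 0 →
        KobayashiMainConjecture W 2 1 ∧ KobayashiLowerDivisibility W 2 1 := by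
  intro W _ _ hW hL
  subst hW
  haveI := isElliptic_cmA27a
  haveI := isGloballyMinimal_cmA27a
  exact ThetaPartnerXRoute.kobayashiMainConjecture_two_baseChange_int_of_thetaPartner _ _ hmod hT hCM hKato
    SSColemanRoad.not_hasCM_157113h1 hL SSColemanRoad.goodSS_two_157113h1.2.2 SSColemanRoad.goodSS_two_157113h1.2.1
    hasCM_cmA27a hLA goodSS_two_cmA27a.2.2 goodSS_two_cmA27a.2.1 _ _
    tschirnhaus_root_157113h1 tschirnhaus_inv_157113h1

end SSThetaRoad
end Summit.BirchSwinnertonDyer.BirchSwinnertonDyer.Theorems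

end
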